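/-
HONEST FRAMING: certified error envelopes and provably optimal rounding/accumulation schemes for
low-precision formats under stated cost models; every table by two implementations; no hardware
or vendor claims.
-/
import Summits.Ventures.CertifiedArithmetic.LowPrec.OptDemotionRoutingThreeFam

/-!
# The demotion law (Theorem T8), part 11-9: SUBADDITIVITY OF THE ROUTING VALUE OVER A PARTITION OF THE CONFIGURATION (opt's row family SUB), every `q`

opt gen 15/16 (kfam.py `build_rows`, family `SUB(C₁|C₂)`; gen16 README §8.6 request (3)): for a
routable configuration `S` and any sub-configuration `C ⊆ S`, every tree and every precision,

  `BR_t(S) ≤ BR_t(C) + BR_t(S ∖ C)`        (`treeBR_subadditive`).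

Part 10g `treeBR_le_erase_add` is the case `|S ∖ C| = 1` (opt's DEL); opt's q = 6 node-step supports
(support_q6_k3_*.json) use SUB with both parts of size ≥ 2 (E2: 2, O: 17, Φ3: 1 uses), and asked
for the Lean row.  PROOF (parts 9b/10d machinery): take a supporting routing `G` of `S` at the
weight `2^e` (`exists_isCoef_support`); its support lies in the residue classes mod `q` of the bits
of `S` (`isCoef_support`), which split into the classes of `C` and of `S ∖ C` (distinct bits of a
routable configuration are incongruent mod `q`); the score of `G` at the weight restricted to the
classes of `C` is at most the value of `S` at that weight, which by deletion (part 8b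
`treeBRw_le_filter`) and locality (`treeBRw_congr`) is `BR_t(C)`; likewise for `S ∖ C`.
-/

namespace Summit.Ventures.CertifiedArithmetic.LowPrec.Opt

open Literature.ComputerArithmetic.JeannerodRump2018
open Literature.ComputerArithmetic.JeannerodRump2018.SumTree

section Sub

variable {q : ℕ}

/-- Scores at two weights agreeing on the support of the coefficient vector coincide. -/
theorem score_congr_support {W W' : ℤ → ℚ} {G : ℤ →₀ ℚ} (h : ∀ e, G e ≠ 0 → W e = W' e) :
    score W G = score W' G := by
  unfold score Finsupp.sum
  refine Finset.sum_congr rfl fun e he => ?_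
  show G e * W e = G e * W' e
  rw [h e (Finsupp.mem_support_iff.1 he)]

/-- The value of `S` at the weight `2^e` restricted to the residue classes of a sub-configuration
`C ⊆ S` is at most `BR_t(C)`. -/
theorem treeBRw_classes_le (t : SumTree) {S C : Finset ℤ} (hS : Routable q S) (hC : C ⊆ S) :
    treeBRw q (fun e => if ∃ c ∈ C, (q : ℤ) ∣ e - c then (2 : ℚ) ^ e else 0) t S ≤ treeBR q t C := by
  classical
  set WC : ℤ → ℚ := fun e => if ∃ c ∈ C, (q : ℤ) ∣ e - c then (2 : ℚ) ^ e else 0 with hWC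
  have hWC0 : ∀ e, 0 ≤ WC e := fun e => by
    simp only [hWC]; split_ifs
    · exact (zpow_pos (by norm_num) e).le
    · exact le_rfl
  have hp : ∀ e : ℤ, (∃ c ∈ C, (q : ℤ) ∣ (e - q) - c) ↔ ∃ c ∈ C, (q : ℤ) ∣ e - c := fun e => by
    constructor
    · rintro ⟨c, hc, h⟩; exact ⟨c, hc, (dvd_sub_shift_iff _ _ _).1 h⟩
    · rintro ⟨c, hc, h⟩; exact ⟨c, hc, (dvd_sub_shift_iff _ _ _).2 h⟩
  have h1 := treeBRw_le_filter (q := q) (W := WC) hWC0 (p := fun e => ∃ c ∈ C, (q : ℤ) ∣ e - c) hp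
    (fun e he => by simp only [hWC]; rw [if_neg he]) t S hS
  have hfil : S.filter (fun e => ∃ c ∈ C, (q : ℤ) ∣ e - c) = C := by
    ext e
    simp only [Finset.mem_filter]
    constructor
    · rintro ⟨he, c, hc, h⟩
      rw [eq_of_routable_of_dvd hS he (hC hc) h]; exact hc
    · intro he; exact ⟨hC he, e, he, by simp⟩
  rw [hfil] at h1
  have hcl : treeBRw q WC t C = treeBR q t C := by
    rw [treeBR]
    refine treeBRw_congr (p := fun e => ∃ c ∈ C, (q : ℤ) ∣ e - c) (fun e h => (hp e).2 h)
      (fun e h => by simp only [hWC]; rw [if_pos h]) t C (fun e he => ⟨e, he, by simp⟩)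
  rw [hcl] at h1
  exact h1

/-- **SUBADDITIVITY OVER A PARTITION (opt's SUB), every tree, every precision**: for a routable
configuration `S` and `C ⊆ S`, `BR_t(S) ≤ BR_t(C) + BR_t(S ∖ C)`. -/
theorem treeBR_subadditive (t : SumTree) {S C : Finset ℤ} (hS : Routable q S) (hC : C ⊆ S) :
    treeBR q t S ≤ treeBR q t C + treeBR q t (S \ C) := by
  classical
  have h2pos : ∀ e : ℤ, (0 : ℚ) < (2 : ℚ) ^ e := fun e => zpow_pos (by norm_num) e
  obtain ⟨G, hG, hGeq, hsupp⟩ := exists_isCoef_support (q := q) (W := fun e => (2 : ℚ) ^ e)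
    (fun e => (h2pos e).le) t hS
  set WC : ℤ → ℚ := fun e => if ∃ c ∈ C, (q : ℤ) ∣ e - c then (2 : ℚ) ^ e else 0 with hWC
  set WD : ℤ → ℚ := fun e => if ∃ c ∈ S \ C, (q : ℤ) ∣ e - c then (2 : ℚ) ^ e else 0 with hWD
  -- the support of `G` lies in the classes of `S`, which split into those of `C` and of `S ∖ C`
  have hsup : ∀ e, G e ≠ 0 → ∃ s ∈ S, (q : ℤ) ∣ e - s :=
    isCoef_support (q := q) (p := fun e => ∃ s ∈ S, (q : ℤ) ∣ e - s)
      (fun e ⟨s, hs, h⟩ => ⟨s, hs, (dvd_sub_shift_iff _ _ _).2 h⟩) t S G hG (fun e he => ⟨e, he, by simp⟩)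
  have hsplit : ∀ e, G e ≠ 0 → (2 : ℚ) ^ e = WC e + WD e := by
    intro e he
    obtain ⟨s, hs, h⟩ := hsup e he
    by_cases hsC : s ∈ C
    · have hD : ¬ ∃ c ∈ S \ C, (q : ℤ) ∣ e - c := by
        rintro ⟨c, hc, h'⟩
        have hcS := (Finset.mem_sdiff.1 hc).1
        have : s = c := eq_of_routable_of_dvd hS hs hcS (by
          have := dvd_sub h' h; rwa [show e - c - (e - s) = s - c by ring] at this)
        exact (Finset.mem_sdiff.1 hc).2 (this ▸ hsC)
      simp only [hWC, hWD]; rw [if_pos ⟨s, hsC, h⟩, if_neg hD, add_zero]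
    · have hCn : ¬ ∃ c ∈ C, (q : ℤ) ∣ e - c := by
        rintro ⟨c, hc, h'⟩
        have : s = c := eq_of_routable_of_dvd hS hs (hC hc) (by
          have := dvd_sub h' h; rwa [show e - c - (e - s) = s - c by ring] at this)
        exact hsC (this ▸ hc)
      simp only [hWC, hWD]; rw [if_neg hCn, if_pos ⟨s, Finset.mem_sdiff.2 ⟨hs, hsC⟩, h⟩, zero_add]
  have hsc : score (fun e => (2 : ℚ) ^ e) G = score WC G + score WD G := by
    rw [← score_add_weight]; exact score_congr_support hsplit
  have hCle := (hsupp WC).trans (treeBRw_classes_le t hS hC)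
  have hDle := (hsupp WD).trans (treeBRw_classes_le t hS Finset.sdiff_subset)
  rw [treeBR, ← hGeq, hsc]
  exact add_le_add hCle hDle

/-- SUB for two disjoint configurations whose union is routable: `BR(C₁ ∪ C₂) ≤ BR(C₁) + BR(C₂)`. -/
theorem treeBR_union_le (t : SumTree) {C₁ C₂ : Finset ℤ} (hS : Routable q (C₁ ∪ C₂))
    (hd : Disjoint C₁ C₂) : treeBR q t (C₁ ∪ C₂) ≤ treeBR q t C₁ + treeBR q t C₂ := by
  have h := treeBR_subadditive t hS Finset.subset_union_left
  rwa [Finset.union_sdiff_left, Finset.sdiff_eq_self_of_disjoint hd.symm] at h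

end Sub

end Summit.Ventures.CertifiedArithmetic.LowPrec.Opt
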